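import Mathlib
import Literature.Analysis.FluidPDE.SelfSimilar
import Literature.Analysis.FluidPDE.TypeIAncientMild
import Literature.Analysis.FluidPDE.CurlFreeLiouville
import Summits.NavierStokesRegularity.NavierStokesRegularity.Theorems.SymmetryModuliCountStretchingCertificateComparison
import Summits.NavierStokesRegularity.NavierStokesRegularity.Theorems.DssFarFieldSlavingBlowupTypeIDssProfileSmoothRepresentativeAe
import Summits.NavierStokesRegularity.NavierStokesRegularity.Theorems.DssFarFieldSlavingBlowupTypeIDssProfileStrainBudget
import HarnessLib

/-!
# The periodic strain / certificate budget: T32′ and T35′ of the pub-ns-dss census as tree theorems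
  (route `DssFarFieldSlaving`, crux `BlowupTypeIDssProfile`, stmt-NavierStokesRegularity-0155 — SUPPORT;
  cell pub-ns-dss, THEORY seat g5 (statements + proofs), to be landed by the typer seat after
  `…Theorems.DssFarFieldSlavingBlowupTypeIDssProfileStrainBudget` (typer g3, sha256[16] f37d92551e099576), which it imports.)

HONEST FRAMING (theory seat). Bookkeeping only, no new analysis: the time-weighted certificate theorems of the
imported file (`typeI_ancient_eq_zero_of_strainBudget`, `typeI_ancient_eq_zero_of_certificateBudget`: route
SymmetryModuliCount's stretching-certificate maximum principle with a weight depending on time only + KNSS 2009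
Lemma 3.1 / Remark 6.1) are fed the budget manufactured from a smooth PERIODIC majorant with period mean `< 1`.
Nothing here is a statement about Navier–Stokes regularity or blow-up; an empty cell is a solver control /
diagnosis. CHECK STATUS: this file cannot be `lean check`ed standalone before its import lands; it was checked by
concatenation with the imported file's exact content (sha f37d92551e099576): rc 0 / 0 sorries / 0 warnings, axioms
[propext, Classical.choice, Quot.sound] for both class wrappers.

CONTENT. `exists_periodic_budget` (pure calculus): for `L > 0` and a smooth `L`-periodic `Λ` with mean
`m = (∫₀ᴸ Λ)/L` there is `g`, smooth and `≥ 0` on `t < 0`, with `g′(t) = (Λ(−log(−t)) − m)/(−t)` — `g(t) = G(−log(−t)) − min G`,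
`G` the zero-mean primitive of `Λ − m` (smooth, periodic, bounded). `typeI_ancient_eq_zero_of_periodicStrainMajorant`
(T32′): `IsTypeIAncientMild C V`, `∫₀ᴸ Λ < L`, `⟪∇V(t,x)ξ,ξ⟫ ≤ (Λ(−log(−t))/(−t))‖ξ‖²` ⇒ `V ≡ 0` on `t < 0` (with
`δ := 1 − m`: `(1 − δ)/(−t) + g′(t) = Λ(s)/(−t)` exactly). `typeI_ancient_eq_zero_of_periodicCertificateMajorant` (T35′,
sup-form, Constantin–Fefferman direction term kept): the same with `(−t)(⟪∇V ξ,ξ⟫ − |∇ξ|²_F) ≤ Λ(−log(−t))` at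
vorticity-carrying points. Class wrappers `rdssClass_periodicStrainMajorant_empty`, `rdssClass_periodicCertificateMajorant_empty`
(representatives quantified universally, as in the E23/E24 wrappers). In census language: for an `s`-periodic member the
period MEAN of `sup_y λ_max(S̃(·,s))` (resp. of `sup_{Ω≠0}(ξ̃ᵀS̃ξ̃ − |∇_yξ̃|²_F)`) is `≥ 1` — precisely: no smooth periodic
majorant with mean `< 1` exists. What stays on paper: the argmax refinement of T35′ (hypothesis only where `|Ω(·,s)|²` is
maximal), the lim sup clause for non-periodic members, and the mollification one-liner producing a smooth majorant from a
continuous one. WHY IT STOPS: perturbative — the mean must stay `< 1`. CONTENT RANGE (red R-67, gen 13): in the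
STRAIN form the hypothesis is satisfiable only at phases with `Λ(s) ≥ 0` — `tr S = div V = 0` forbids `⟪∇V ξ, ξ⟫ ≤ (Λ(s)/(−t))‖ξ‖²`
for all `ξ` with `Λ(s) < 0` — so a majorant dipping below `0` makes the statement vacuously true there (no content is claimed
for `Λ < 0`; the meaningful range is `Λ ≥ 0`, mean `< 1`); in the CERTIFICATE form `Λ(s) < 0` is a genuine, stronger sub-case
(the certificate `⟪∇V ξ,ξ⟫ − |∇ξ|²_F` can be negative). SCOPE: the budget constrains the FAR PAST only (`g ≥ 0` ⇔ the running
mean of `Λ` over `[s, s₀]` is eventually `≤ 1 − δ + o(1)` as `s → −∞`); the forward behaviour is free; the periodic reading is the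
special case where every window of length `L` has the same mean.
[cite: KochNadirashviliSereginSverak2009, Lemma 3.1 and Remark 6.1 (arXiv:0709.3599)]
[cite: ConstantinFefferman1993, §1]
-/

noncomputable section

set_option linter.dupNamespace false

namespace Summit.NavierStokesRegularity.NavierStokesRegularity.Theorems.SubcriticalStrain

open Set Function Filter MeasureTheory
open scoped RealInnerProductSpace Laplacian ContDiff Topology
open Literature.Analysis Literature.Analysis.FluidPDE
open Summit.NavierStokesRegularity.NavierStokesRegularity.Theorems

/-! ## The periodic budget (pub-ns-dss THEORY seat g5: T32′ / T35′ in kernel form)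

HONEST FRAMING (theory seat). Bookkeeping only, no new analysis: a smooth `L`-periodic function `Λ` with
`∫₀ᴸ Λ < L` (period mean `m < 1`) is turned into a budget `g ≥ 0`, smooth on `t < 0` (NOT at `t = 0`:
it oscillates), with `(1 − δ)/(−t) + g′(t) = Λ(−log(−t))/(−t)` for `δ := 1 − m`
(`g(t) = G(−log(−t)) − min G`, `G` = the zero-mean primitive of `Λ − m`: smooth, `L`-periodic, bounded);
the budget theorems above then give the PERIODIC READINGS T32′ / T35′ of the theory seat's census
(«for an s-periodic member the period mean of sup_y λ_max(S̃(·,s)), resp. of the certificate defect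
sup_{Ω≠0}(ξ̃ᵀS̃ξ̃ − |∇_yξ̃|²_F), is ≥ 1»): `Λ` is any smooth periodic MAJORANT of that quantity — no
regularity of the supremum itself is assumed, and the period `L` of the majorant is free (for a
`(c,R)`-RDSS member the natural one is `L = 2 log c`). Level: profile-pointwise / classical for the
representative `V`; class level through the representative wrapper, as for E23/E24. Nothing here is a
statement about Navier–Stokes regularity or blow-up. -/

/-- **Periodic budget (pure calculus).** For `L > 0` and a smooth `L`-periodic `Λ : ℝ → ℝ` with period
mean `m = (∫ s in 0..L, Λ s)/L` there is `g : ℝ → ℝ`, smooth and non-negative on `t < 0`, with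
`deriv g t = (Λ(−log(−t)) − m)/(−t)` for `t < 0` — namely `g t = G(−log(−t)) − min G` with `G` the
zero-mean primitive of `Λ − m` (smooth, `L`-periodic, hence bounded below). [folklore] -/
theorem exists_periodic_budget {L : ℝ} (hL : 0 < L) {Λ : ℝ → ℝ} (hΛ : ContDiff ℝ (⊤ : ℕ∞) Λ)
    (hper : Function.Periodic Λ L) :
    ∃ g : ℝ → ℝ, ContDiffOn ℝ (⊤ : ℕ∞) g (Iio 0) ∧ (∀ t < 0, 0 ≤ g t) ∧
      ∀ t < 0, deriv g t = (Λ (-Real.log (-t)) - (∫ s in (0:ℝ)..L, Λ s) / L) / (-t) := by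
  set m : ℝ := (∫ s in (0:ℝ)..L, Λ s) / L with hm
  -- the zero-mean primitive of `Λ − m`
  set G : ℝ → ℝ := fun s => ∫ σ in (0:ℝ)..s, (Λ σ - m) with hG
  have hcont : Continuous fun σ => Λ σ - m := hΛ.continuous.sub continuous_const
  have hGd : ∀ s, HasDerivAt G (Λ s - m) s := fun s =>
    (hcont.integral_hasStrictDerivAt 0 s).hasDerivAt
  have hGdiff : Differentiable ℝ G := fun s => (hGd s).differentiableAt
  have hGderiv : deriv G = fun s => Λ s - m := funext fun s => (hGd s).deriv
  have hGsmooth : ContDiff ℝ (⊤ : ℕ∞) G := by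
    refine contDiff_infty_iff_deriv.2 ⟨hGdiff, ?_⟩
    rw [hGderiv]
    exact hΛ.sub contDiff_const
  have hGcont : Continuous G := hGsmooth.continuous
  -- `G` is `L`-periodic because `Λ − m` has zero mean over a period
  have hint : ∀ a b : ℝ, IntervalIntegrable (fun σ => Λ σ - m) volume a b := fun a b =>
    hcont.intervalIntegrable a b
  have hperm : Function.Periodic (fun σ => Λ σ - m) L := fun σ => by
    show Λ (σ + L) - m = Λ σ - m
    rw [hper σ]
  have hzero : ∀ s : ℝ, ∫ σ in s..s + L, (Λ σ - m) = 0 := by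
    intro s
    rw [hperm.intervalIntegral_add_eq s 0, zero_add,
      intervalIntegral.integral_sub (hΛ.continuous.intervalIntegrable 0 L)
        (continuous_const.intervalIntegrable 0 L),
      intervalIntegral.integral_const, smul_eq_mul, hm]
    have hL0 : L ≠ 0 := hL.ne'
    have hc : (L - 0) * ((∫ s in (0:ℝ)..L, Λ s) / L) = ∫ s in (0:ℝ)..L, Λ s := by
      rw [sub_zero]; field_simp
    rw [hc]
    exact sub_self _
  have hperiod : Function.Periodic G L := by
    intro s
    have hsplit : G (s + L) = G s + ∫ σ in s..s + L, (Λ σ - m) := by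
      simp only [hG]
      rw [intervalIntegral.integral_add_adjacent_intervals (hint 0 s) (hint s (s + L))]
    rw [hsplit, hzero s, add_zero]
  -- a continuous periodic function is bounded below: minimum over one period
  obtain ⟨s₀, -, hs₀⟩ := isCompact_Icc.exists_isMinOn (nonempty_Icc.2 hL.le) hGcont.continuousOn
  have hlow : ∀ s, G s₀ ≤ G s := by
    intro s
    obtain ⟨y, hy, hGy⟩ := hperiod.exists_mem_Ico₀ hL s
    rw [hGy]
    exact hs₀ (Ico_subset_Icc_self hy)
  -- the budget in physical time: `g t = G(−log(−t)) − G s₀`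
  refine ⟨fun t => G (-Real.log (-t)) - G s₀, ?_, fun t _ => sub_nonneg.2 (hlow _), ?_⟩
  · have hφ : ContDiffOn ℝ (⊤ : ℕ∞) (fun t : ℝ => -Real.log (-t)) (Iio 0) := by
      refine (Real.contDiffOn_log.comp contDiff_neg.contDiffOn ?_).neg
      intro t ht
      simp only [mem_compl_iff, mem_singleton_iff, neg_eq_zero]
      exact ne_of_lt ht
    exact (hGsmooth.comp_contDiffOn hφ).sub contDiffOn_const
  · intro t ht
    have hnt : -t ≠ 0 := (neg_pos.2 ht).ne'
    have hφd : HasDerivAt (fun t : ℝ => -Real.log (-t)) ((-t)⁻¹) t := by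
      have h1 : HasDerivAt (fun t : ℝ => Real.log (-t)) ((-t)⁻¹ * (-1)) t :=
        (Real.hasDerivAt_log hnt).comp t (hasDerivAt_neg' t)
      have hval : -((-t)⁻¹ * (-1 : ℝ)) = (-t)⁻¹ := by ring
      have h2 := h1.neg
      rw [hval] at h2
      exact h2
    have hgd : HasDerivAt (fun t => G (-Real.log (-t)) - G s₀)
        ((Λ (-Real.log (-t)) - m) * (-t)⁻¹) t :=
      ((hGd _).comp t hφd).sub_const _
    rw [hgd.deriv, div_eq_mul_inv]

/-- **T32′ in kernel form: a PERIODIC strain majorant with period mean `< 1` kills Type-I ancient mild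
solutions.** `IsTypeIAncientMild C V`; `Λ` smooth and `L`-periodic (`L > 0`) with `∫ s in 0..L, Λ s < L`;
`⟪∇V(t,x) ξ, ξ⟫ ≤ (Λ(−log(−t))/(−t)) ‖ξ‖²` for all `t < 0`, `x`, `ξ` (in similarity variables:
`sup_y λ_max(S̃(y,s)) ≤ Λ(s)`) ⇒ `V ≡ 0` on `t < 0`. Proof: `exists_periodic_budget` with `δ := 1 − m`,
then `typeI_ancient_eq_zero_of_strainBudget`. The constant majorant `Λ ≡ Λ₀ < 1` is T32
(`SubcriticalStrain.typeI_ancient_subcriticalStrain_eq_zero`). Census reading (theory EXPLICIT-THRESHOLDS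
T32′, NULL-TESTS n18(f)): every genuine `s`-periodic state has period-MEAN of `sup_y λ_max(S̃)` `≥ 1`,
not only period-max. [cite: KochNadirashviliSereginSverak2009, Lemma 3.1 and Remark 6.1 (arXiv:0709.3599)] -/
theorem typeI_ancient_eq_zero_of_periodicStrainMajorant {C L : ℝ} (hL : 0 < L)
    {Λ : ℝ → ℝ} (hΛ : ContDiff ℝ (⊤ : ℕ∞) Λ) (hper : Function.Periodic Λ L)
    (hmean : ∫ s in (0:ℝ)..L, Λ s < L)
    {V : ℝ → EuclideanSpace ℝ (Fin 3) → EuclideanSpace ℝ (Fin 3)} (hV : IsTypeIAncientMild C V)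
    (hstrain : ∀ t < 0, ∀ x ξ : EuclideanSpace ℝ (Fin 3),
      ⟪fderiv ℝ (V t) x ξ, ξ⟫ ≤ Λ (-Real.log (-t)) / (-t) * ‖ξ‖ ^ 2) :
    ∀ t < 0, ∀ x, V t x = 0 := by
  obtain ⟨g, hg, hg0, hgd⟩ := exists_periodic_budget hL hΛ hper
  set m : ℝ := (∫ s in (0:ℝ)..L, Λ s) / L with hm
  have hm1 : m < 1 := (div_lt_one hL).2 hmean
  have hδ : 0 < 1 - m := sub_pos.2 hm1
  refine typeI_ancient_eq_zero_of_strainBudget hδ hg hg0 hV fun t ht x ξ => ?_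
  have hnt : -t ≠ 0 := (neg_pos.2 ht).ne'
  have ht0 : t ≠ 0 := ht.ne
  have key : (1 - (1 - m)) / (-t) + deriv g t = Λ (-Real.log (-t)) / (-t) := by
    rw [hgd t ht]
    field_simp
    ring
  rw [key]
  exact hstrain t ht x ξ

/-- **T35′ in kernel form: a PERIODIC majorant of the certificate defect with period mean `< 1` kills
Type-I ancient mild solutions** (Constantin–Fefferman's direction term kept). `IsTypeIAncientMild C V`;
`Λ` smooth, `L`-periodic, `∫ s in 0..L, Λ s < L`; at every point with `curl V ≠ 0`,
`(−t)(⟪∇V ξ, ξ⟫ − |∇ξ|²_F) ≤ Λ(−log(−t))` for the vorticity direction `ξ = ω/|ω|` ⇒ `V ≡ 0` on `t < 0`.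
Proof: `exists_periodic_budget`, then `typeI_ancient_eq_zero_of_certificateBudget`. The constant majorant
is the theory seat's T35 (`CertificateThreshold.typeI_ancient_subcriticalCertificate_eq_zero`).
[cite: KochNadirashviliSereginSverak2009, Lemma 3.1 and Remark 6.1 (arXiv:0709.3599)]
[cite: ConstantinFefferman1993, §1] -/
theorem typeI_ancient_eq_zero_of_periodicCertificateMajorant {C L : ℝ} (hL : 0 < L)
    {Λ : ℝ → ℝ} (hΛ : ContDiff ℝ (⊤ : ℕ∞) Λ) (hper : Function.Periodic Λ L)
    (hmean : ∫ s in (0:ℝ)..L, Λ s < L)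
    {V : ℝ → EuclideanSpace ℝ (Fin 3) → EuclideanSpace ℝ (Fin 3)} (hV : IsTypeIAncientMild C V)
    (hcert : ∀ t < 0, ∀ x, curl (V t) x ≠ 0 →
      (-t) * (⟪fderiv ℝ (V t) x (vorticityDirection (curl (V t)) x), vorticityDirection (curl (V t)) x⟫
        - frobeniusNormSq (fderiv ℝ (vorticityDirection (curl (V t))) x)) ≤ Λ (-Real.log (-t))) :
    ∀ t < 0, ∀ x, V t x = 0 := by
  obtain ⟨g, hg, hg0, hgd⟩ := exists_periodic_budget hL hΛ hper
  set m : ℝ := (∫ s in (0:ℝ)..L, Λ s) / L with hm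
  have hm1 : m < 1 := (div_lt_one hL).2 hmean
  have hδ : 0 < 1 - m := sub_pos.2 hm1
  refine typeI_ancient_eq_zero_of_certificateBudget hδ hg hg0 hV fun t ht x hω => ?_
  have hnt : -t ≠ 0 := (neg_pos.2 ht).ne'
  have ht0 : t ≠ 0 := ht.ne
  have key : 1 - (1 - m) + (-t) * deriv g t = Λ (-Real.log (-t)) := by
    rw [hgd t ht]
    field_simp
    ring
  rw [key]
  exact hcert t ht x hω

/-- **CLASS level (T32′): the periodic-strain-majorant cell of the hypothesis class of
`RdssProfileTruncation` is EMPTY.** For every Type-I bound `M` and every smooth `L`-periodic `Λ` with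
`∫₀ᴸ Λ < L` there is no member (any factor `c > 1`, any twist `R`) all of whose smooth Type-I
representatives `V` satisfy `⟪∇V(t,x) ξ, ξ⟫ ≤ (Λ(−log(−t))/(−t)) ‖ξ‖²` — representatives quantified
universally as in the E23/E24 wrappers (the class speaks about an a.e. object). [this file]
[cite: KochNadirashviliSereginSverak2009, Lemma 3.1 and Remark 6.1 (arXiv:0709.3599)] -/
theorem rdssClass_periodicStrainMajorant_empty (M : ℝ) {L : ℝ} (hL : 0 < L)
    {Λ : ℝ → ℝ} (hΛ : ContDiff ℝ (⊤ : ℕ∞) Λ) (hper : Function.Periodic Λ L)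
    (hmean : ∫ s in (0:ℝ)..L, Λ s < L) :
    ¬ ∃ (c : ℝ) (R : (EuclideanSpace ℝ (Fin 3)) ≃ₗᵢ[ℝ] (EuclideanSpace ℝ (Fin 3)))
        (u : ℝ → (EuclideanSpace ℝ (Fin 3)) → (EuclideanSpace ℝ (Fin 3))),
      1 < c ∧ IsAncientMildSolution 1 u ∧ (∀ t < 0, AEStronglyMeasurable (u t) volume) ∧
      IsRotatedDSS c R u ∧ HasTypeIDecay M u ∧
      (∀ V : ℝ → EuclideanSpace ℝ (Fin 3) → EuclideanSpace ℝ (Fin 3), IsTypeIAncientMild M V →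
        (∀ t < 0, V t =ᵐ[volume] u t) →
        ∀ t < 0, ∀ x ξ : EuclideanSpace ℝ (Fin 3),
          ⟪fderiv ℝ (V t) x ξ, ξ⟫ ≤ Λ (-Real.log (-t)) / (-t) * ‖ξ‖ ^ 2) ∧
      ¬ (∀ t < 0, u t =ᵐ[volume] 0) := by
  rintro ⟨c, R, u, -, hmild, hmeas, -, hdec, hstrain, hne⟩
  obtain ⟨V, hT, -, hVu, -⟩ := typeI_ancient_smoothRepresentative_ae hmild hmeas hdec
  have hz : ∀ t < 0, ∀ x, V t x = 0 :=
    typeI_ancient_eq_zero_of_periodicStrainMajorant hL hΛ hper hmean hT (hstrain V hT hVu)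
  refine hne fun t ht => ?_
  have hVz : V t = 0 := funext fun x => by simpa using hz t ht x
  exact (hVu t ht).symm.trans (Filter.EventuallyEq.of_eq hVz)

/-- **CLASS level (T35′): the periodic-certificate-majorant cell is EMPTY** — as
`rdssClass_periodicStrainMajorant_empty` with the certificate defect (direction term kept) in place of the
strain. [this file] [cite: KochNadirashviliSereginSverak2009, Lemma 3.1 and Remark 6.1 (arXiv:0709.3599)] -/
theorem rdssClass_periodicCertificateMajorant_empty (M : ℝ) {L : ℝ} (hL : 0 < L)
    {Λ : ℝ → ℝ} (hΛ : ContDiff ℝ (⊤ : ℕ∞) Λ) (hper : Function.Periodic Λ L)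
    (hmean : ∫ s in (0:ℝ)..L, Λ s < L) :
    ¬ ∃ (c : ℝ) (R : (EuclideanSpace ℝ (Fin 3)) ≃ₗᵢ[ℝ] (EuclideanSpace ℝ (Fin 3)))
        (u : ℝ → (EuclideanSpace ℝ (Fin 3)) → (EuclideanSpace ℝ (Fin 3))),
      1 < c ∧ IsAncientMildSolution 1 u ∧ (∀ t < 0, AEStronglyMeasurable (u t) volume) ∧
      IsRotatedDSS c R u ∧ HasTypeIDecay M u ∧
      (∀ V : ℝ → EuclideanSpace ℝ (Fin 3) → EuclideanSpace ℝ (Fin 3), IsTypeIAncientMild M V →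
        (∀ t < 0, V t =ᵐ[volume] u t) →
        ∀ t < 0, ∀ x, curl (V t) x ≠ 0 →
          (-t) * (⟪fderiv ℝ (V t) x (vorticityDirection (curl (V t)) x),
              vorticityDirection (curl (V t)) x⟫
            - frobeniusNormSq (fderiv ℝ (vorticityDirection (curl (V t))) x)) ≤ Λ (-Real.log (-t))) ∧
      ¬ (∀ t < 0, u t =ᵐ[volume] 0) := by
  rintro ⟨c, R, u, -, hmild, hmeas, -, hdec, hcert, hne⟩
  obtain ⟨V, hT, -, hVu, -⟩ := typeI_ancient_smoothRepresentative_ae hmild hmeas hdec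
  have hz : ∀ t < 0, ∀ x, V t x = 0 :=
    typeI_ancient_eq_zero_of_periodicCertificateMajorant hL hΛ hper hmean hT (hcert V hT hVu)
  refine hne fun t ht => ?_
  have hVz : V t = 0 := funext fun x => by simpa using hz t ht x
  exact (hVu t ht).symm.trans (Filter.EventuallyEq.of_eq hVz)

end Summit.NavierStokesRegularity.NavierStokesRegularity.Theorems.SubcriticalStrain

end
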